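import Summits.AtomisticToContinuum.HydrodynamicLimit.Theorems.CollisionIsometryCLTMacroClosureTwoScaleDefs
import Summits.AtomisticToContinuum.HydrodynamicLimit.Theorems.CollisionIsometryCLTMacroClosureTwoScaleCells
import Summits.AtomisticToContinuum.HydrodynamicLimit.Theorems.CollisionIsometryCLTMacroClosureTwoScaleJensenPoint
import Literature.MathematicalPhysics.KineticTheory.HardSphereEulerProofs
import HarnessLib

/-!
# Two-scale block MGF (line `IdeatorTwoGen1Sketch`, crux `MacroClosure`, stmt-AtomisticToContinuum-14870):
# the configurational bound at a fixed shift

Support file (`--supports stmt-AtomisticToContinuum-14870`) of the line lead (continuation c2) towards the registered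
stub `Barycentric.stub_blockMGF_twoScale`: the POSITION part of the cell bound. For a fixed shift `x` of the tiling
of mesh `1/M`, `M = mesh N`, the integral over the hard-core configurations of
`𝟙{all cells have a(N+1)ℓ³ ≤ n_κ ≤ 1.05 σ⁻³(N+1)ℓ³} Π_κ exp(γ'(N+1)ℓ³ confRate(n_κ/((N+1)ℓ³)))` is at most
`(N+2)^{M³} e^{2ε'(N+1)} vol(hard-core configurations)`: decompose over occupation patterns (at most `(N+2)^{M³}`),
bound each pattern's hard-core volume by the pattern-volume and pattern-asymptotics inputs (taken here as
hypotheses in their registered forms) and the partition function from below, and use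
`Σ_κ (N+1)ℓ³ confRate(ρ̄_κ) = Σ_κ [n_κ log ρ̄_κ + n_κ f_ex(ρ̄_κσ³)] − (N+1) f_ex(σ³) ≥ 0` (explicit form and
non-negativity of `confRate`, also hypotheses in their registered forms) with `γ' ≤ 1`.
-/

noncomputable section

open MeasureTheory Filter Set Topology InformationTheory
open scoped ENNReal ContDiff Convolution

namespace Summit.AtomisticToContinuum.HydrodynamicLimit.Theorems.MacroClosureLine

open Literature.MathematicalPhysics.KineticTheory Literature.Analysis.FluidPDE
open Literature.Analysis.FunctionSpaces

namespace Barycentric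

namespace BlockMGFTwoScale

variable {N : ℕ}

/-- The level sets of the occupation number of a fixed cube, as a function of the positions, are measurable.
[folklore] -/
theorem measurableSet_cellCount_eq (ℓ : ℝ) (y : T3) (m : ℕ) :
    MeasurableSet {q : Fin (N + 1) → T3 | cellCount ℓ (zipConfig (q, fun _ => (0 : V3))) y = m} := by
  classical
  -- decompose over the finitely many index sets of cardinality `m`
  have hA : ∀ i : Fin (N + 1), MeasurableSet {q : Fin (N + 1) → T3 | inCube ℓ (q i - y)} := fun i =>
    show MeasurableSet ((fun q : Fin (N + 1) → T3 => q i - y) ⁻¹' {w | inCube ℓ w}) from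
      (JensenPoint.measurableSet_inCube ℓ).preimage ((measurable_pi_apply i).sub measurable_const)
  have hT : ∀ T : Finset (Fin (N + 1)),
      MeasurableSet {q : Fin (N + 1) → T3 | cellSet ℓ (zipConfig (q, fun _ => (0 : V3))) y = T} := by
    intro T
    have : {q : Fin (N + 1) → T3 | cellSet ℓ (zipConfig (q, fun _ => (0 : V3))) y = T} =
        ⋂ i, {q | inCube ℓ (q i - y) ↔ i ∈ T} := by
      ext q
      simp only [Set.mem_setOf_eq, Set.mem_iInter, cellSet, Finset.ext_iff, Finset.mem_filter,
        Finset.mem_univ, true_and, zipConfig_apply]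
    rw [this]
    refine MeasurableSet.iInter fun i => ?_
    by_cases hi : i ∈ T
    · have e : {q : Fin (N + 1) → T3 | (inCube ℓ (q i - y) ↔ i ∈ T)} = {q | inCube ℓ (q i - y)} := by
        ext q; simp only [Set.mem_setOf_eq, hi, iff_true]
      rw [e]; exact hA i
    · have e : {q : Fin (N + 1) → T3 | (inCube ℓ (q i - y) ↔ i ∈ T)} = {q | inCube ℓ (q i - y)}ᶜ := by
        ext q; simp only [Set.mem_setOf_eq, hi, iff_false, Set.mem_compl_iff]
      rw [e]; exact (hA i).compl
  have : {q : Fin (N + 1) → T3 | cellCount ℓ (zipConfig (q, fun _ => (0 : V3))) y = m} =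
      ⋃ T ∈ (Finset.univ : Finset (Finset (Fin (N + 1)))).filter (fun T => T.card = m),
        {q | cellSet ℓ (zipConfig (q, fun _ => (0 : V3))) y = T} := by
    ext q
    simp only [Set.mem_setOf_eq, Set.mem_iUnion, Finset.mem_filter, Finset.mem_univ, true_and,
      exists_prop, cellCount]
    constructor
    · intro h; exact ⟨_, h, rfl⟩
    · rintro ⟨T, hT, rfl⟩; exact hT
  rw [this]
  exact Finset.measurableSet_biUnion _ fun T _ => hT T

/-- The occupation vector of the cells of the `x`-shifted tiling, as a function of the positions, is measurable
(it takes values in a countable type). [folklore] -/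
theorem measurable_occ (ℓ : ℝ) {K : Type} [Fintype K] (c : K → T3) :
    Measurable fun q : Fin (N + 1) → T3 => fun κ : K => cellCount ℓ (zipConfig (q, fun _ => (0 : V3))) (c κ) := by
  refine measurable_pi_iff.2 fun κ => ?_
  refine measurable_to_countable' fun m => ?_
  exact measurableSet_cellCount_eq ℓ (c κ) m

/-- **The configurational bound at a fixed shift, fixed `N` (core).** Abstract form: mesh `M`, box side `ℓ = 1/M`,
hard-core distance `d`; the pattern-volume bound `hPV`, the pattern asymptotics `h1`, the partition function bound `h2`
and the explicit form / non-negativity of `confRate` are hypotheses. [folklore] -/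
theorem positionBound_core {N M : ℕ} (hM : 0 < M) (σ a γ' ε' ℓ d : ℝ) (ha : 0 < a)
    (hγ'1 : γ' ≤ 1) (hℓM : ℓ = ((M : ℕ) : ℝ)⁻¹) (uc : V3) (θc : ℝ) (x : T3)
    (hRa : ∀ r : ℝ, r ≠ 0 → confRate σ uc θc r = r * Real.log r - r + 1 +
      (r * hsExcessFreeEnergy (r * σ ^ 3) - hsExcessFreeEnergy (σ ^ 3) -
        (hsExcessFreeEnergy (σ ^ 3) + σ ^ 3 * deriv hsExcessFreeEnergy (σ ^ 3)) * (r - 1)))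
    (hRb : ∀ r : ℝ, 0 < r → r * σ ^ 3 < 11 / 10 → 0 ≤ confRate σ uc θc r)
    (B₀ : ((Fin 3 → Fin M) → ℕ) → ℝ)
    (hPV : ∀ n : (Fin 3 → Fin M) → ℕ, ∑ κ, n κ = N + 1 →
      (volume ({q : Fin (N + 1) → T3 | ∀ κ : Fin 3 → Fin M,
          cellCount ℓ (zipConfig (q, fun _ => (0 : V3))) (x + Torus.proj (Torus.cellCorner M κ)) = n κ} ∩
        posDomain d (N + 1))).toReal ≤ B₀ n)
    (h1 : ∀ n : (Fin 3 → Fin M) → ℕ, (∀ κ, a * (((N : ℝ) + 1) * ℓ ^ 3) ≤ n κ) →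
      (∀ κ, (n κ : ℝ) * σ ^ 3 ≤ (1 + 1 / 64) ^ 3 * (((N : ℝ) + 1) * ℓ ^ 3)) → ∑ κ, n κ = N + 1 →
      B₀ n ≤ Real.exp (-(∑ κ : Fin 3 → Fin M, ((n κ : ℝ) * Real.log ((n κ : ℝ) / (((N : ℝ) + 1) * ℓ ^ 3)) +
        (n κ : ℝ) * hsExcessFreeEnergy ((n κ : ℝ) * σ ^ 3 / (((N : ℝ) + 1) * ℓ ^ 3)))) + ε' * ((N : ℝ) + 1)))
    (h2 : Real.exp (-(((N : ℝ) + 1) * (hsExcessFreeEnergy (σ ^ 3) + ε'))) ≤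
      (volume (posDomain d (N + 1))).toReal) :
    ∫⁻ q, (posDomain d (N + 1)).indicator (fun q =>
        {q : Fin (N + 1) → T3 | ∀ κ : Fin 3 → Fin M,
            a * (((N : ℝ) + 1) * ℓ ^ 3) ≤
              (cellCount ℓ (zipConfig (q, fun _ => (0 : V3))) (x + Torus.proj (Torus.cellCorner M κ)) : ℝ) ∧
            (cellCount ℓ (zipConfig (q, fun _ => (0 : V3))) (x + Torus.proj (Torus.cellCorner M κ)) : ℝ) * σ ^ 3 ≤
              (1 + 1 / 64) ^ 3 * (((N : ℝ) + 1) * ℓ ^ 3)}.indicator (fun q =>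
          ∏ κ : Fin 3 → Fin M, ENNReal.ofReal (Real.exp (γ' * (((N : ℝ) + 1) * ℓ ^ 3) *
            confRate σ uc θc ((cellCount ℓ (zipConfig (q, fun _ => (0 : V3)))
              (x + Torus.proj (Torus.cellCorner M κ)) : ℝ) / (((N : ℝ) + 1) * ℓ ^ 3))))) q) q
      ≤ ((N : ℝ≥0∞) + 2) ^ M ^ 3 * ENNReal.ofReal (Real.exp (2 * ε' * ((N : ℝ) + 1))) *
        volume (posDomain d (N + 1)) := by
  have hℓpos : 0 < ℓ := by rw [hℓM]; exact inv_pos.2 (Nat.cast_pos.2 hM)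
  set V : ℝ := ((N : ℝ) + 1) * ℓ ^ 3 with hV
  have hV0 : 0 < V := by positivity
  set c : (Fin 3 → Fin M) → T3 := fun κ => x + Torus.proj (Torus.cellCorner M κ) with hc
  set occ : (Fin (N + 1) → T3) → (Fin 3 → Fin M) → ℕ :=
    fun q κ => cellCount ℓ (zipConfig (q, fun _ => (0 : V3))) (c κ) with hocc
  set pD : Set (Fin (N + 1) → T3) := posDomain d (N + 1) with hpD
  set Occ : Set (Fin (N + 1) → T3) := {q | ∀ κ, a * V ≤ (occ q κ : ℝ) ∧ (occ q κ : ℝ) * σ ^ 3 ≤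
    (1 + 1 / 64) ^ 3 * V} with hOcc
  set A : ((Fin 3 → Fin M) → ℕ) → ℝ≥0∞ := fun n =>
    ∏ κ, ENNReal.ofReal (Real.exp (γ' * V * confRate σ uc θc ((n κ : ℝ) / V))) with hA
  show ∫⁻ q, pD.indicator (fun q => Occ.indicator (fun q => A (occ q)) q) q ≤ _
  -- the bound, pattern by pattern
  set B : ℝ≥0∞ := ENNReal.ofReal (Real.exp (2 * ε' * ((N : ℝ) + 1))) * volume pD with hB
  -- occupation numbers never exceed `N + 1`
  have hocc_le : ∀ q κ, occ q κ < N + 2 := fun q κ =>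
    Nat.lt_succ_of_le ((Finset.card_le_univ _).trans (by simp))
  -- the patterns as a finite type
  set P : Type := (Fin 3 → Fin M) → Fin (N + 2)
  set toPat : (Fin (N + 1) → T3) → P := fun q κ => ⟨occ q κ, hocc_le q κ⟩ with htoPat
  set J : P → (Fin (N + 1) → T3) → ℝ≥0∞ := fun p q =>
    (pD ∩ {q | toPat q = p} ∩ Occ).indicator (fun _ => A (fun κ => (p κ : ℕ))) q with hJ
  -- Step 1: the integrand is dominated by the sum of the pattern pieces
  have hdom : ∀ q, pD.indicator (fun q => Occ.indicator (fun q => A (occ q)) q) q ≤ ∑ p, J p q := by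
    intro q
    by_cases hq : q ∈ pD
    · by_cases hq' : q ∈ Occ
      · rw [Set.indicator_of_mem hq, Set.indicator_of_mem hq']
        refine le_trans ?_ (Finset.single_le_sum (f := fun p => J p q) (fun p _ => zero_le)
          (Finset.mem_univ (toPat q)))
        simp only [hJ]
        rw [Set.indicator_of_mem (show q ∈ pD ∩ {q' | toPat q' = toPat q} ∩ Occ from ⟨⟨hq, rfl⟩, hq'⟩)]
      · rw [Set.indicator_of_mem hq, Set.indicator_of_notMem hq']; exact zero_le
    · rw [Set.indicator_of_notMem hq]; exact zero_le
  -- measurability of the pattern level sets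
  have hmeas_pat : ∀ p : P, MeasurableSet {q : Fin (N + 1) → T3 | toPat q = p} := by
    intro p
    have : {q : Fin (N + 1) → T3 | toPat q = p} = (fun q => occ q) ⁻¹' {fun κ => (p κ : ℕ)} := by
      ext q
      simp only [Set.mem_setOf_eq, Set.mem_preimage, Set.mem_singleton_iff]
      constructor
      · intro h; funext κ; exact congrArg Fin.val (congrFun h κ)
      · intro h; funext κ; exact Fin.ext (congrFun h κ)
    rw [this]
    exact (measurable_occ ℓ c) (measurableSet_singleton _)
  have hmeas_Occ : MeasurableSet Occ := by
    have : Occ = (fun q => occ q) ⁻¹' {n | ∀ κ, a * V ≤ (n κ : ℝ) ∧ (n κ : ℝ) * σ ^ 3 ≤ (1 + 1 / 64) ^ 3 * V} := by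
      ext q; simp only [hOcc, Set.mem_setOf_eq, Set.mem_preimage]
    rw [this]
    exact (measurable_occ ℓ c) (MeasurableSet.of_discrete)
  have hmeas_pD : MeasurableSet pD := measurableSet_posDomain d (N + 1)
  have hJm : ∀ p, Measurable (J p) := fun p =>
    measurable_const.indicator ((hmeas_pD.inter (hmeas_pat p)).inter hmeas_Occ)
  -- Step 2: each pattern piece integrates to at most `B`
  have hpiece : ∀ p : P, ∫⁻ q, J p q ≤ B := by
    intro p
    set n : (Fin 3 → Fin M) → ℕ := fun κ => (p κ : ℕ) with hn
    simp only [hJ]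
    rw [lintegral_indicator ((hmeas_pD.inter (hmeas_pat p)).inter hmeas_Occ), setLIntegral_const]
    -- is the pattern compatible with the floor / ceiling and non-empty?
    by_cases hne : (pD ∩ {q | toPat q = p} ∩ Occ).Nonempty
    swap
    · rw [Set.not_nonempty_iff_eq_empty.1 hne, measure_empty, mul_zero]; exact zero_le
    obtain ⟨q₀, ⟨_, hq₀p⟩, hq₀O⟩ := hne
    have hq₀p' : ∀ κ, occ q₀ κ = n κ := fun κ => congrArg Fin.val (congrFun hq₀p κ)
    -- floor, ceiling and total of the pattern
    have hfloor : ∀ κ, a * V ≤ (n κ : ℝ) := fun κ => by rw [← hq₀p' κ]; exact (hq₀O κ).1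
    have hceil : ∀ κ, (n κ : ℝ) * σ ^ 3 ≤ (1 + 1 / 64) ^ 3 * V := fun κ => by
      rw [← hq₀p' κ]; exact (hq₀O κ).2
    have hsum : ∑ κ, n κ = N + 1 := by
      have h := ((stub_twoScale_cells M hM x).2.2.2 N (zipConfig (q₀, fun _ => (0 : V3)))).2
      rw [← hℓM] at h
      rw [← h]
      exact Finset.sum_congr rfl fun κ _ => (hq₀p' κ).symm
    have hnpos : ∀ κ, 0 < (n κ : ℝ) := fun κ => lt_of_lt_of_le (by positivity) (hfloor κ)
    -- the volume of the pattern
    have hvol_le : volume (pD ∩ {q | toPat q = p} ∩ Occ) ≤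
        ENNReal.ofReal (Real.exp (-(∑ κ, ((n κ : ℝ) * Real.log ((n κ : ℝ) / V) +
          (n κ : ℝ) * hsExcessFreeEnergy ((n κ : ℝ) * σ ^ 3 / V))) + ε' * ((N : ℝ) + 1))) := by
      have hsub : pD ∩ {q | toPat q = p} ∩ Occ ⊆
          {q : Fin (N + 1) → T3 | ∀ κ : Fin 3 → Fin M,
            cellCount ℓ (zipConfig (q, fun _ => (0 : V3))) (x + Torus.proj (Torus.cellCorner M κ)) = n κ} ∩
            posDomain d (N + 1) := by
        rintro q ⟨⟨hq1, hq2⟩, -⟩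
        refine ⟨fun κ => ?_, hq1⟩
        show occ q κ = (p κ : ℕ)
        exact congrArg Fin.val (congrFun hq2 κ)
      have hfin : volume ({q : Fin (N + 1) → T3 | ∀ κ : Fin 3 → Fin M,
            cellCount ℓ (zipConfig (q, fun _ => (0 : V3))) (x + Torus.proj (Torus.cellCorner M κ)) = n κ} ∩
            posDomain d (N + 1)) ≠ ⊤ := measure_ne_top _ _
      calc volume (pD ∩ {q | toPat q = p} ∩ Occ)
          ≤ volume ({q : Fin (N + 1) → T3 | ∀ κ : Fin 3 → Fin M,
            cellCount ℓ (zipConfig (q, fun _ => (0 : V3))) (x + Torus.proj (Torus.cellCorner M κ)) = n κ} ∩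
            posDomain d (N + 1)) := measure_mono hsub
        _ = ENNReal.ofReal (volume ({q : Fin (N + 1) → T3 | ∀ κ : Fin 3 → Fin M,
            cellCount ℓ (zipConfig (q, fun _ => (0 : V3))) (x + Torus.proj (Torus.cellCorner M κ)) = n κ} ∩
            posDomain d (N + 1))).toReal := (ENNReal.ofReal_toReal hfin).symm
        _ ≤ ENNReal.ofReal (B₀ n) := ENNReal.ofReal_le_ofReal (hPV n hsum)
        _ ≤ _ := ENNReal.ofReal_le_ofReal (h1 n hfloor hceil hsum)
    -- the partition function from below
    have hZ : ENNReal.ofReal (Real.exp (-(((N : ℝ) + 1) * (hsExcessFreeEnergy (σ ^ 3) + ε')))) ≤ volume pD := by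
      calc ENNReal.ofReal (Real.exp (-(((N : ℝ) + 1) * (hsExcessFreeEnergy (σ ^ 3) + ε'))))
          ≤ ENNReal.ofReal ((volume pD).toReal) := ENNReal.ofReal_le_ofReal h2
        _ ≤ volume pD := ENNReal.ofReal_toReal_le
    -- the configurational sum and its sign
    set Cf : ℝ := ∑ κ, V * confRate σ uc θc ((n κ : ℝ) / V) with hCf
    have hcard : ((Fintype.card (Fin 3 → Fin M) : ℕ) : ℝ) * V = (N : ℝ) + 1 := by
      rw [Fintype.card_fun, Fintype.card_fin, Fintype.card_fin, hV, hℓM]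
      have hM0 : ((M : ℕ) : ℝ) ≠ 0 := Nat.cast_ne_zero.2 hM.ne'
      push_cast
      field_simp
    have hsumR : ∑ κ, (n κ : ℝ) = (N : ℝ) + 1 := by exact_mod_cast congrArg (fun m : ℕ => (m : ℝ)) hsum
    have hCf_eq : Cf = ∑ κ, ((n κ : ℝ) * Real.log ((n κ : ℝ) / V) +
        (n κ : ℝ) * hsExcessFreeEnergy ((n κ : ℝ) * σ ^ 3 / V)) - ((N : ℝ) + 1) * hsExcessFreeEnergy (σ ^ 3) := by
      have hterm : ∀ κ, V * confRate σ uc θc ((n κ : ℝ) / V) =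
          ((n κ : ℝ) * Real.log ((n κ : ℝ) / V) + (n κ : ℝ) * hsExcessFreeEnergy ((n κ : ℝ) * σ ^ 3 / V)) +
          ((V - (n κ : ℝ)) - V * hsExcessFreeEnergy (σ ^ 3) -
            (hsExcessFreeEnergy (σ ^ 3) + σ ^ 3 * deriv hsExcessFreeEnergy (σ ^ 3)) * ((n κ : ℝ) - V)) := by
        intro κ
        have hr : (n κ : ℝ) / V ≠ 0 := (div_pos (hnpos κ) hV0).ne'
        rw [hRa _ hr]
        have e1 : (n κ : ℝ) / V * σ ^ 3 = (n κ : ℝ) * σ ^ 3 / V := by ring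
        rw [e1]
        field_simp
        ring
      rw [hCf, Finset.sum_congr rfl fun κ _ => hterm κ, Finset.sum_add_distrib]
      have hlin : ∑ κ : Fin 3 → Fin M, ((V - (n κ : ℝ)) - V * hsExcessFreeEnergy (σ ^ 3) -
          (hsExcessFreeEnergy (σ ^ 3) + σ ^ 3 * deriv hsExcessFreeEnergy (σ ^ 3)) * ((n κ : ℝ) - V)) =
          -(((N : ℝ) + 1) * hsExcessFreeEnergy (σ ^ 3)) := by
        have hsV : ∑ _κ : Fin 3 → Fin M, V = (N : ℝ) + 1 := by
          rw [Finset.sum_const, Finset.card_univ, nsmul_eq_mul, hcard]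
        calc ∑ κ : Fin 3 → Fin M, ((V - (n κ : ℝ)) - V * hsExcessFreeEnergy (σ ^ 3) -
              (hsExcessFreeEnergy (σ ^ 3) + σ ^ 3 * deriv hsExcessFreeEnergy (σ ^ 3)) * ((n κ : ℝ) - V))
            = ∑ κ : Fin 3 → Fin M, (V * (1 - hsExcessFreeEnergy (σ ^ 3) +
                (hsExcessFreeEnergy (σ ^ 3) + σ ^ 3 * deriv hsExcessFreeEnergy (σ ^ 3))) -
                (1 + (hsExcessFreeEnergy (σ ^ 3) + σ ^ 3 * deriv hsExcessFreeEnergy (σ ^ 3))) * (n κ : ℝ)) :=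
              Finset.sum_congr rfl fun κ _ => by ring
          _ = (∑ _κ : Fin 3 → Fin M, V) * (1 - hsExcessFreeEnergy (σ ^ 3) +
                (hsExcessFreeEnergy (σ ^ 3) + σ ^ 3 * deriv hsExcessFreeEnergy (σ ^ 3))) -
              (1 + (hsExcessFreeEnergy (σ ^ 3) + σ ^ 3 * deriv hsExcessFreeEnergy (σ ^ 3))) *
                ∑ κ : Fin 3 → Fin M, (n κ : ℝ) := by
              rw [Finset.sum_sub_distrib, Finset.sum_mul, Finset.mul_sum]
          _ = -(((N : ℝ) + 1) * hsExcessFreeEnergy (σ ^ 3)) := by rw [hsV, hsumR]; ring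
      rw [hlin]
      ring
    have hCf_nonneg : 0 ≤ Cf := by
      refine Finset.sum_nonneg fun κ _ => mul_nonneg hV0.le (hRb _ (div_pos (hnpos κ) hV0) ?_)
      rw [div_mul_eq_mul_div, div_lt_iff₀ hV0]
      calc (n κ : ℝ) * σ ^ 3 ≤ (1 + 1 / 64) ^ 3 * V := hceil κ
        _ < 11 / 10 * V := by nlinarith
    -- `A n = exp(γ' Cf)`
    have hA_eq : A n = ENNReal.ofReal (Real.exp (γ' * Cf)) := by
      simp only [hA]
      rw [← ENNReal.ofReal_prod_of_nonneg fun κ _ => (Real.exp_pos _).le, ← Real.exp_sum, hCf,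
        Finset.mul_sum]
      congr 2
      refine Finset.sum_congr rfl fun κ _ => ?_
      ring
    -- assemble
    calc A (fun κ => (p κ : ℕ)) * volume (pD ∩ {q | toPat q = p} ∩ Occ)
        ≤ ENNReal.ofReal (Real.exp (γ' * Cf)) *
          ENNReal.ofReal (Real.exp (-(∑ κ, ((n κ : ℝ) * Real.log ((n κ : ℝ) / V) +
            (n κ : ℝ) * hsExcessFreeEnergy ((n κ : ℝ) * σ ^ 3 / V))) + ε' * ((N : ℝ) + 1))) := by
          rw [← hA_eq]; gcongr
      _ = ENNReal.ofReal (Real.exp (γ' * Cf - Cf + ε' * ((N : ℝ) + 1) -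
            ((N : ℝ) + 1) * hsExcessFreeEnergy (σ ^ 3))) := by
          rw [← ENNReal.ofReal_mul (Real.exp_pos _).le, ← Real.exp_add]
          congr 2
          rw [hCf_eq]
          ring
      _ ≤ ENNReal.ofReal (Real.exp (2 * ε' * ((N : ℝ) + 1)) *
            Real.exp (-(((N : ℝ) + 1) * (hsExcessFreeEnergy (σ ^ 3) + ε')))) := by
          refine ENNReal.ofReal_le_ofReal ?_
          rw [← Real.exp_add]
          refine Real.exp_le_exp.2 ?_
          have : γ' * Cf - Cf ≤ 0 := by nlinarith
          nlinarith
      _ = ENNReal.ofReal (Real.exp (2 * ε' * ((N : ℝ) + 1))) *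
            ENNReal.ofReal (Real.exp (-(((N : ℝ) + 1) * (hsExcessFreeEnergy (σ ^ 3) + ε')))) :=
          ENNReal.ofReal_mul (Real.exp_pos _).le
      _ ≤ B := by rw [hB]; gcongr
  -- Step 3: sum over the patterns
  calc ∫⁻ q, pD.indicator (fun q => Occ.indicator (fun q => A (occ q)) q) q
      ≤ ∫⁻ q, ∑ p, J p q := lintegral_mono hdom
    _ = ∑ p, ∫⁻ q, J p q := lintegral_finsetSum' _ fun p _ => (hJm p).aemeasurable
    _ ≤ ∑ _p : P, B := Finset.sum_le_sum fun p _ => hpiece p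
    _ = (Fintype.card P : ℝ≥0∞) * B := by rw [Finset.sum_const, Finset.card_univ, nsmul_eq_mul]
    _ = ((N : ℝ≥0∞) + 2) ^ M ^ 3 * ENNReal.ofReal (Real.exp (2 * ε' * ((N : ℝ) + 1))) * volume pD := by
        rw [hB, ← mul_assoc]
        congr 1
        simp only [P, Fintype.card_fun, Fintype.card_fin]
        push_cast
        ring


/-- **The configurational bound at a fixed shift, eventually in `N`.** See the module docstring; `ℓ = side N`,
`M = mesh N`, `d = hsDiameter σ N`; the four analytic inputs (explicit form and non-negativity of `confRate`, the
pattern volume, the pattern asymptotics with the partition-function lower bound) are hypotheses in their registered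
forms. [folklore] -/
theorem positionBound : ∀ (σ a γ' ε' : ℝ), 0 < σ → 0 < a → γ' ≤ 1 → ∀ (uc : V3) (θc : ℝ),
    (∀ r : ℝ, r ≠ 0 → confRate σ uc θc r = r * Real.log r - r + 1 +
      (r * hsExcessFreeEnergy (r * σ ^ 3) - hsExcessFreeEnergy (σ ^ 3) -
        (hsExcessFreeEnergy (σ ^ 3) + σ ^ 3 * deriv hsExcessFreeEnergy (σ ^ 3)) * (r - 1))) →
    (∀ r : ℝ, 0 < r → r * σ ^ 3 < 11 / 10 → 0 ≤ confRate σ uc θc r) →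
    (∀ (M : ℕ), 0 < M → ∀ (x : T3) (N : ℕ) (d : ℝ), 0 ≤ d →
      ∀ (n : (Fin 3 → Fin M) → ℕ), ∑ κ, n κ = N + 1 →
      (volume ({q : Fin (N + 1) → T3 | ∀ κ : Fin 3 → Fin M,
          cellCount ((M : ℝ)⁻¹) (zipConfig (q, fun _ => (0 : V3))) (x + Torus.proj (Torus.cellCorner M κ)) = n κ} ∩
        posDomain d (N + 1))).toReal ≤
      ((N + 1).factorial : ℝ) / (∏ κ, ((n κ).factorial : ℝ)) *
        ∏ κ : Fin 3 → Fin M, (((M : ℝ)⁻¹) ^ (3 * n κ) *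
          (volume {w : Fin (n κ) → V3 | (∀ i l, 0 ≤ w i l ∧ w i l ≤ 1) ∧
            ∀ i j, i ≠ j → d / (M : ℝ)⁻¹ ≤ ‖w i - w j‖}).toReal)) →
    (∀ᶠ N : ℕ in atTop, ∀ n : (Fin 3 → Fin (mesh N)) → ℕ,
      (∀ κ, a * (((N : ℝ) + 1) * side N ^ 3) ≤ n κ) →
      (∀ κ, (n κ : ℝ) * σ ^ 3 ≤ (1 + 1 / 64) ^ 3 * (((N : ℝ) + 1) * side N ^ 3)) →
      ∑ κ, n κ = N + 1 →
      ((N + 1).factorial : ℝ) / (∏ κ, ((n κ).factorial : ℝ)) *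
        ∏ κ : Fin 3 → Fin (mesh N), (side N ^ (3 * n κ) *
          (volume {w : Fin (n κ) → V3 | (∀ i l, 0 ≤ w i l ∧ w i l ≤ 1) ∧
            ∀ i j, i ≠ j → hsDiameter σ N / side N ≤ ‖w i - w j‖}).toReal) ≤
      Real.exp (-(∑ κ : Fin 3 → Fin (mesh N), ((n κ : ℝ) * Real.log ((n κ : ℝ) / (((N : ℝ) + 1) * side N ^ 3)) +
        (n κ : ℝ) * hsExcessFreeEnergy ((n κ : ℝ) * σ ^ 3 / (((N : ℝ) + 1) * side N ^ 3)))) + ε' * ((N : ℝ) + 1))) →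
    (∀ᶠ N : ℕ in atTop, Real.exp (-(((N : ℝ) + 1) * (hsExcessFreeEnergy (σ ^ 3) + ε'))) ≤
      (volume (posDomain (hsDiameter σ N) (N + 1))).toReal) →
    ∀ᶠ N : ℕ in atTop, ∀ x : T3,
      ∫⁻ q, (posDomain (hsDiameter σ N) (N + 1)).indicator (fun q =>
          {q : Fin (N + 1) → T3 | ∀ κ : Fin 3 → Fin (mesh N),
              a * (((N : ℝ) + 1) * side N ^ 3) ≤
                (cellCount (side N) (zipConfig (q, fun _ => (0 : V3))) (x + Torus.proj (Torus.cellCorner (mesh N) κ)) : ℝ) ∧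
              (cellCount (side N) (zipConfig (q, fun _ => (0 : V3))) (x + Torus.proj (Torus.cellCorner (mesh N) κ)) : ℝ) * σ ^ 3 ≤
                (1 + 1 / 64) ^ 3 * (((N : ℝ) + 1) * side N ^ 3)}.indicator (fun q =>
            ∏ κ : Fin 3 → Fin (mesh N), ENNReal.ofReal (Real.exp (γ' * (((N : ℝ) + 1) * side N ^ 3) *
              confRate σ uc θc ((cellCount (side N) (zipConfig (q, fun _ => (0 : V3)))
                (x + Torus.proj (Torus.cellCorner (mesh N) κ)) : ℝ) / (((N : ℝ) + 1) * side N ^ 3))))) q) q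
        ≤ ((N : ℝ≥0∞) + 2) ^ (mesh N) ^ 3 * ENNReal.ofReal (Real.exp (2 * ε' * ((N : ℝ) + 1))) *
          volume (posDomain (hsDiameter σ N) (N + 1)) := by
  intro σ a γ' ε' hσ ha hγ'1 uc θc hRa hRb hPV hPA1 hPA2
  filter_upwards [hPA1, hPA2] with N h1 h2 x
  have hd0 : 0 ≤ hsDiameter σ N := by
    rw [hsDiameter]; exact mul_nonneg hσ.le (Real.rpow_nonneg (by positivity) _)
  exact positionBound_core (mesh_pos N) σ a γ' ε' (side N) (hsDiameter σ N) ha hγ'1 rfl uc θc x hRa hRb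
    _ (fun n hs => hPV (mesh N) (mesh_pos N) x N (hsDiameter σ N) hd0 n hs) (fun n hf hc hs => h1 n hf hc hs) h2

end BlockMGFTwoScale

end Barycentric

end Summit.AtomisticToContinuum.HydrodynamicLimit.Theorems.MacroClosureLine

end
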